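import Mathlib
import Summits.ValiantsHypothesis.ValiantsHypothesis.Theses.TwoAdicLadder
import Summits.ValiantsHypothesis.ValiantsHypothesis.Theorems.TwoAdicLadderLadderOfVHTransfer
import Literature.Computability.AlgebraicComplexity.StandardFamiliesProofs
import Literature.Computability.AlgebraicComplexity.ValiantConjectureEquivProofs
import Literature.Computability.AlgebraicComplexity.RazElusiveGeneralProofs
import HarnessLib

/-!
# Route TwoAdicLadder — `LadderOfVH` (stmt-ValiantsHypothesis-5952): the precision ladder is not
# stronger than the summit

`LadderOfVH : ValiantsHypothesis → PrecisionLadder` (support, calibration: "refuting PrecisionLadder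
= refuting VH"). Proof, as the planner sketched it but ultrafilter-free: if the ladder fails with
exponent `c`, then for all large `n` and EVERY precision `k` some admissible ring `R_{n,k}` (finite
commutative principal ideal ring, `2` nilpotent, `2^k ≠ 0`) has `L_{R_{n,k}}(per_n) ≤ n^c`; by the
transfer `complexity_map_complex_le_of_twoAdic` (`…Theorems/TwoAdicLadderLadderOfVHTransfer.lean`:
integer universal circuit + a prime of `Π_k R_{n,k}` avoiding `2^ℕ` + Nullstellensatz transfer to
`ℂ`) `L_ℂ(per_n) ≤ 21877 (n² + n + n^c + 2)²⁶` for all large `n`, so the permanent is p-computable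
over `ℂ` (`IsPBounded.of_eventually_le`), i.e. `VP_ℂ = VNP_ℂ` (`perNotPComputableComplex_iff_holds`),
contradicting `ValiantsHypothesis`. Only the admissibility clauses "`2` nilpotent" and "`2^k ≠ 0`"
are used (finiteness and principality of the `R_{n,k}` are not needed for this direction).

Honest framing: calibration glue of a conditional route; `VP ≠ VNP` is NOT proved and nothing here
is progress on it.

## References

* P. Bürgisser, *Completeness and Reduction in Algebraic Complexity Theory* (2000), §4.1 and
  Rem. 2.11 / Thm. 2.10. [cite: Burgisser2000, §4.1]
-/

set_option linter.dupNamespace false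

noncomputable section

open MvPolynomial

namespace Summit.ValiantsHypothesis.ValiantsHypothesis.Theorems.TwoAdicLadder

open Literature.Computability.AlgebraicComplexity Filter

/-- **Per-`n` transfer for the permanent.** If for every precision `k` some commutative ring `R_k`
with `2` nilpotent and `2^k ≠ 0` has `L_{R_k}(per_n) ≤ s`, then
`L_ℂ(per_n) ≤ 21877 · (n² + n + s + 2)²⁶` (`complexity_map_complex_le_of_twoAdic` for the integer
permanent renamed to `Fin (n·n)` variables; `deg per_n = n`). [cite: Burgisser2000, §4.1] -/
theorem complexity_perPoly_complex_le_of_twoAdic (n s : ℕ) (R : ℕ → Type) [∀ k, CommRing (R k)]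
    (h2 : ∀ k, IsNilpotent (2 : R k)) (hk : ∀ k, (2 : R k) ^ k ≠ 0)
    (hc : ∀ k, complexity (perPoly (Fin n) (R k)) ≤ s) :
    complexity (perPoly (Fin n) ℂ) ≤ 21877 * (n * n + n + s + 2) ^ 26 := by
  classical
  let e : Fin n × Fin n ≃ Fin (n * n) := finProdFinEquiv
  let f₀ : MvPolynomial (Fin (n * n)) ℤ := rename e (perPoly (Fin n) ℤ)
  have hmap : ∀ (B : Type) [CommRing B],
      MvPolynomial.map (Int.castRingHom B) f₀ = rename e (perPoly (Fin n) B) := by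
    intro B _
    simp only [f₀, map_rename, map_perPoly]
  have hdeg : f₀.totalDegree ≤ n := by
    refine (totalDegree_rename_le _ _).trans ?_
    rw [totalDegree_perPoly_holds, Fintype.card_fin]
  have hcR : ∀ k, complexity (MvPolynomial.map (Int.castRingHom (R k)) f₀) ≤ s := by
    intro k
    rw [hmap, complexity_rename_of_injective_holds e.injective]
    exact hc k
  have h := complexity_map_complex_le_of_twoAdic f₀ s R h2 hk hcR
  rw [hmap, complexity_rename_of_injective_holds e.injective] at h
  refine h.trans ?_
  gcongr

/-- **`LadderOfVH` (stmt-ValiantsHypothesis-5952): `ValiantsHypothesis → PrecisionLadder`.**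
If the ladder failed with exponent `c`, then for all large `n` every precision `k` would admit a
ring `R_{n,k}` (`2` nilpotent, `2^k ≠ 0`) with `L(per_n) ≤ n^c`, whence
`L_ℂ(per_n) ≤ 21877 (n² + n + n^c + 2)²⁶` for all large `n` (`complexity_perPoly_complex_le_of_twoAdic`),
the permanent would be p-computable over `ℂ`, and `VP_ℂ = VNP_ℂ`
(`perNotPComputableComplex_iff_holds`) — contradicting `ValiantsHypothesis`. Calibration only:
`VP ≠ VNP` is NOT proved here. [cite: Burgisser2000, §4.1] -/
theorem ladderOfVH_proof :
    Summit.ValiantsHypothesis.ValiantsHypothesis.Theses.TwoAdicLadder.LadderOfVH := by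
  unfold Theses.TwoAdicLadder.LadderOfVH Theses.TwoAdicLadder.PrecisionLadder
  intro hVH c
  by_contra hnot
  rw [Filter.not_frequently, Filter.eventually_atTop] at hnot
  obtain ⟨n₀, hn₀⟩ := hnot
  -- for `n ≥ n₀`: a small complex circuit for `per_n`
  have hsmall : ∀ n, n₀ ≤ n →
      complexity (perPoly (Fin n) ℂ) ≤ 21877 * (n * n + n + n ^ c + 2) ^ 26 := by
    intro n hn
    have h := hn₀ n hn
    push Not at h
    choose R instR instF _hPIR h2 hk hc using h
    exact @complexity_perPoly_complex_le_of_twoAdic n (n ^ c) R instR h2 hk hc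
  -- hence the permanent is p-computable over `ℂ`
  have hP : IsPComputable fun n => perPoly (Fin n) ℂ := by
    let q : Polynomial ℕ := 21877 * (Polynomial.X * Polynomial.X + Polynomial.X + Polynomial.X ^ c + 2) ^ 26
    have hq : IsPBounded fun n => 21877 * (n * n + n + n ^ c + 2) ^ 26 :=
      (isPBounded_iff_exists_polynomial_holds _).2 ⟨q, fun n => by simp [q]⟩
    exact IsPBounded.of_eventually_le n₀ hq hsmall
  exact (perNotPComputableComplex_iff_holds.mpr hVH) hP

end Summit.ValiantsHypothesis.ValiantsHypothesis.Theorems.TwoAdicLadder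

end
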